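import Mathlib

/-!
# Shooting polynomial, landing uniqueness and the nondegenerate Jacobian of the similarity low state
(solo-blind, s43)

The `η → 0` (i.e. `δ → 0`) limit of the outer steady problem of the reduced model is, in rational
similarity units `Y = X/√6`, the third-order equation `R''' = Y² - 1/6` with an upstream cubic contact
`R = R' = R'' = 0` at `Y = a` and a downstream tangential landing `R = R' = 0` at `Y = c > a`.

* `shootR a` is the (unique) solution of the initial-value problem from the cubic contact at `a`; it is an
  explicit quintic, `shootR a Y = (Y-a)³ ((a²-1/6)/6 + a (Y-a)/12 + (Y-a)²/60)`.
* `landing_unique`: the landing system `shootR a c = 0, ∂_Y shootR a c = 0, a < c` has the unique solution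
  `(a, c) = (-2/3, 1)`, and `shootR (-2/3) = simR` is the similarity profile of
  `SoloBlindSimilarityLowState`.
* The Jacobian of the shooting map `Ψ(a, c) = (shootR a c, ∂_Y shootR a c)` at `(-2/3, 1)` is the
  triangular matrix `[[-125/324, 0], [-25/54, 25/162]]` with determinant `-3125/52488 ≠ 0`
  (`hasDerivAt_shootR_a`, `hasDerivAt_shootR1_a`, `hasDerivAt_shootR_Y`, `hasDerivAt_shootR1_Y`,
  `landingJac_det`).

Since the exactly rescaled outer equation depends smoothly on `η` and reduces to `R''' = Y² - 1/6` at
`η = 0`, the implicit function theorem applied to `Ψ` gives the persistence of the isolated low state for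
all sufficiently small `δ` and every smooth carrier of the class (CLAIMS SB-C435; paper §24.23).  This file
records the exact algebra and calculus behind that step.
-/

namespace Summit.AnomalousDissipation.AnomalousDissipation.Theorems

open Real

/-- Generic derivative of a real quintic `c₅x⁵ + c₄x⁴ + c₃x³ + c₂x² + c₁x + c₀`. -/
theorem hasDerivAt_quintic (c0 c1 c2 c3 c4 c5 x : ℝ) :
    HasDerivAt (fun x : ℝ => c5 * x ^ 5 + c4 * x ^ 4 + c3 * x ^ 3 + c2 * x ^ 2 + c1 * x + c0)
      (5 * c5 * x ^ 4 + 4 * c4 * x ^ 3 + 3 * c3 * x ^ 2 + 2 * c2 * x + c1) x := by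
  have h1 := ((((((hasDerivAt_pow 5 x).const_mul c5).add ((hasDerivAt_pow 4 x).const_mul c4)).add
    ((hasDerivAt_pow 3 x).const_mul c3)).add ((hasDerivAt_pow 2 x).const_mul c2)).add
    ((hasDerivAt_id' x).const_mul c1)).add_const c0
  have h2 : HasDerivAt (fun x : ℝ => c5 * x ^ 5 + c4 * x ^ 4 + c3 * x ^ 3 + c2 * x ^ 2 + c1 * x + c0)
      (c5 * (↑(5:ℕ) * x ^ (5 - 1)) + c4 * (↑(4:ℕ) * x ^ (4 - 1)) + c3 * (↑(3:ℕ) * x ^ (3 - 1))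
        + c2 * (↑(2:ℕ) * x ^ (2 - 1)) + c1 * 1) x := h1
  refine h2.congr_deriv ?_
  push_cast; ring

/-- A particular solution of `P''' = Y² - 1/6`. -/
noncomputable def shootP (Y : ℝ) : ℝ := Y ^ 5 / 60 - Y ^ 3 / 36

/-- The shooting solution from a cubic contact at `a`: `R''' = Y² - 1/6`, `R(a) = R'(a) = R''(a) = 0`
(Taylor remainder of `shootP` about `a` beyond second order). -/
noncomputable def shootR (a Y : ℝ) : ℝ :=
  shootP Y - shootP a - (a ^ 4 / 12 - a ^ 2 / 12) * (Y - a) - (a ^ 3 / 3 - a / 6) * (Y - a) ^ 2 / 2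

/-- `∂_Y shootR`. -/
noncomputable def shootR1 (a Y : ℝ) : ℝ :=
  (Y ^ 4 / 12 - Y ^ 2 / 12) - (a ^ 4 / 12 - a ^ 2 / 12) - (a ^ 3 / 3 - a / 6) * (Y - a)

/-- `∂_Y² shootR`. -/
noncomputable def shootR2 (a Y : ℝ) : ℝ := (Y ^ 3 / 3 - Y / 6) - (a ^ 3 / 3 - a / 6)

/-- Factorised form: a triple zero at the contact times a quadratic. -/
theorem shootR_factor (a Y : ℝ) :
    shootR a Y = (Y - a) ^ 3 * ((a ^ 2 - 1/6) / 6 + a * (Y - a) / 12 + (Y - a) ^ 2 / 60) := by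
  unfold shootR shootP; ring

/-- Factorised form of the first derivative: a double zero at the contact times a quadratic. -/
theorem shootR1_factor (a Y : ℝ) :
    shootR1 a Y = (Y - a) ^ 2 * ((a ^ 2 - 1/6) / 2 + a * (Y - a) / 3 + (Y - a) ^ 2 / 12) := by
  unfold shootR1; ring

/-- Initial data of the shooting solution: cubic contact at `a`. -/
theorem shootR_init (a : ℝ) : shootR a a = 0 ∧ shootR1 a a = 0 ∧ shootR2 a a = 0 := by
  refine ⟨?_, ?_, ?_⟩
  · unfold shootR; ring
  · unfold shootR1; ring
  · unfold shootR2; ring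

/-- `∂_Y shootR = shootR1`. -/
theorem hasDerivAt_shootR_Y (a Y : ℝ) : HasDerivAt (shootR a) (shootR1 a Y) Y := by
  have hf : shootR a = fun x : ℝ => (1/60) * x ^ 5 + 0 * x ^ 4 + (-1/36) * x ^ 3
      + (-(a ^ 3) / 6 + a / 12) * x ^ 2 + (a ^ 4 / 4 - a ^ 2 / 12) * x + (-(a ^ 5) / 10 + a ^ 3 / 36) := by
    funext x; unfold shootR shootP; ring
  rw [hf]
  refine (hasDerivAt_quintic _ _ _ _ _ _ Y).congr_deriv ?_
  unfold shootR1; ring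

/-- `∂_Y shootR1 = shootR2`. -/
theorem hasDerivAt_shootR1_Y (a Y : ℝ) : HasDerivAt (shootR1 a) (shootR2 a Y) Y := by
  have hf : shootR1 a = fun x : ℝ => 0 * x ^ 5 + (1/12) * x ^ 4 + 0 * x ^ 3 + (-1/12) * x ^ 2
      + (-(a ^ 3) / 3 + a / 6) * x + (a ^ 4 / 4 - a ^ 2 / 12) := by
    funext x; unfold shootR1; ring
  rw [hf]
  refine (hasDerivAt_quintic _ _ _ _ _ _ Y).congr_deriv ?_
  unfold shootR2; ring

/-- `∂_Y shootR2 = Y² - 1/6`: the outer equation. -/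
theorem hasDerivAt_shootR2_Y (a Y : ℝ) : HasDerivAt (shootR2 a) (Y ^ 2 - 1/6) Y := by
  have hf : shootR2 a = fun x : ℝ => 0 * x ^ 5 + 0 * x ^ 4 + (1/3) * x ^ 3 + 0 * x ^ 2
      + (-1/6) * x + (-(a ^ 3) / 3 + a / 6) := by
    funext x; unfold shootR2; ring
  rw [hf]
  refine (hasDerivAt_quintic _ _ _ _ _ _ Y).congr_deriv ?_
  ring

/-- The third-order ODE satisfied by the shooting solution. -/
theorem deriv3_shootR (a : ℝ) : deriv (deriv (deriv (shootR a))) = fun Y => Y ^ 2 - 1/6 := by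
  have d1 : deriv (shootR a) = shootR1 a := funext fun Y => (hasDerivAt_shootR_Y a Y).deriv
  have d2 : deriv (shootR1 a) = shootR2 a := funext fun Y => (hasDerivAt_shootR1_Y a Y).deriv
  have d3 : deriv (shootR2 a) = fun Y => Y ^ 2 - 1/6 := funext fun Y => (hasDerivAt_shootR2_Y a Y).deriv
  rw [d1, d2, d3]

/-- Two real functions with the same derivative everywhere and the same value at one point coincide. -/
theorem eq_of_hasDerivAt_eq {g h g' : ℝ → ℝ} {a : ℝ} (hg : ∀ Y, HasDerivAt g (g' Y) Y)
    (hh : ∀ Y, HasDerivAt h (g' Y) Y) (h0 : g a = h a) : g = h := by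
  have hd : ∀ Y, HasDerivAt (fun x => g x - h x) 0 Y := fun Y => by
    have h1 : HasDerivAt (fun x => g x - h x) (g' Y - g' Y) Y := (hg Y).sub (hh Y)
    rwa [sub_self] at h1
  have hdiff : Differentiable ℝ (fun x => g x - h x) := fun Y => (hd Y).differentiableAt
  have hz : ∀ Y, deriv (fun x => g x - h x) Y = 0 := fun Y => (hd Y).deriv
  funext Y
  have hc : g Y - h Y = g a - h a := is_const_of_deriv_eq_zero hdiff hz Y a
  linarith

/-- Uniqueness of the initial-value problem: any `C³` chain `f, f₁, f₂` with `f' = f₁`, `f₁' = f₂`,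
`f₂' = Y² - 1/6` and cubic contact at `a` is the shooting solution `shootR a`.  Hence the shooting map
of the `η = 0` problem is exactly `(a, c) ↦ (shootR a c, shootR1 a c)`. -/
theorem shootR_unique {f f1 f2 : ℝ → ℝ} {a : ℝ} (hf : ∀ Y, HasDerivAt f (f1 Y) Y)
    (hf1 : ∀ Y, HasDerivAt f1 (f2 Y) Y) (hf2 : ∀ Y, HasDerivAt f2 (Y ^ 2 - 1/6) Y)
    (h0 : f a = 0) (h1 : f1 a = 0) (h2 : f2 a = 0) : f = shootR a := by
  have e2 : f2 = shootR2 a :=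
    eq_of_hasDerivAt_eq hf2 (fun Y => hasDerivAt_shootR2_Y a Y) (by rw [h2, (shootR_init a).2.2])
  have e1 : f1 = shootR1 a :=
    eq_of_hasDerivAt_eq hf1 (fun Y => by rw [e2]; exact hasDerivAt_shootR1_Y a Y)
      (by rw [h1, (shootR_init a).2.1])
  exact eq_of_hasDerivAt_eq hf (fun Y => by rw [e1]; exact hasDerivAt_shootR_Y a Y)
    (by rw [h0, (shootR_init a).1])

/-- The shooting solution from `a = -2/3` is the similarity profile `(Y + 2/3)³ (Y - 1)² / 60`
(`simR` of `SoloBlindSimilarityLowState`, definitionally). -/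
theorem shootR_neg_two_thirds (Y : ℝ) : shootR (-2/3) Y = (Y + 2/3) ^ 3 * (Y - 1) ^ 2 / 60 := by
  unfold shootR shootP; ring

/-- The landing at `(a, c) = (-2/3, 1)`: `R = R' = 0` and `R''(1) = 25/162`. -/
theorem shootR_landing : shootR (-2/3) 1 = 0 ∧ shootR1 (-2/3) 1 = 0 ∧ shootR2 (-2/3) 1 = 25 / 162 := by
  unfold shootR shootR1 shootR2 shootP; norm_num

/-- LANDING UNIQUENESS: the only cubic-contact / tangential-landing pair with the landing downstream of
the contact is `(a, c) = (-2/3, 1)` (i.e. `X₀ = -√(8/3)`, `X_R = √6` in band units). -/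
theorem landing_unique {a c : ℝ} (hac : a < c) (hR : shootR a c = 0) (hR1 : shootR1 a c = 0) :
    a = -2/3 ∧ c = 1 := by
  rw [shootR_factor] at hR
  rw [shootR1_factor] at hR1
  have hd : 0 < c - a := by linarith
  have hd3 : (c - a) ^ 3 ≠ 0 := pow_ne_zero 3 (ne_of_gt hd)
  have hd2 : (c - a) ^ 2 ≠ 0 := pow_ne_zero 2 (ne_of_gt hd)
  have G1 : (a ^ 2 - 1/6) / 6 + a * (c - a) / 12 + (c - a) ^ 2 / 60 = 0 := by
    rcases mul_eq_zero.mp hR with h | h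
    · exact absurd h hd3
    · exact h
  have G2 : (a ^ 2 - 1/6) / 2 + a * (c - a) / 3 + (c - a) ^ 2 / 12 = 0 := by
    rcases mul_eq_zero.mp hR1 with h | h
    · exact absurd h hd2
    · exact h
  -- G2 - 3 G1 :  (c - a) (5 a + 2 (c - a)) / 60 = 0
  have hlin : (c - a) * (5 * a + 2 * (c - a)) = 0 := by linear_combination (60:ℝ) * G2 - 180 * G1
  have h5 : 5 * a + 2 * (c - a) = 0 := by
    rcases mul_eq_zero.mp hlin with h | h
    · exact absurd h (ne_of_gt hd)
    · exact h
  have hca : c - a = -5 * a / 2 := by linarith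
  have ha_neg : a < 0 := by linarith
  rw [hca] at G2
  have ha2 : a ^ 2 = 4 / 9 := by nlinarith
  have ha : a = -2/3 := by
    have h := mul_self_eq_mul_self_iff.mp (by nlinarith : a * a = (2/3 : ℝ) * (2/3))
    rcases h with h | h
    · exfalso; linarith
    · linarith
  refine ⟨ha, ?_⟩
  subst ha; linarith

/-- `∂_a shootR a Y = -(a² - 1/6)(Y - a)²/2` (derivative of the shooting solution in the contact
position; at the landing it is the `(1,1)` Jacobian entry). -/
theorem hasDerivAt_shootR_a (a Y : ℝ) :
    HasDerivAt (fun a => shootR a Y) (-(a ^ 2 - 1/6) * (Y - a) ^ 2 / 2) a := by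
  have hf : (fun a => shootR a Y) = fun x : ℝ => (-1/10) * x ^ 5 + (Y / 4) * x ^ 4
      + (1/36 - Y ^ 2 / 6) * x ^ 3 + (-(Y / 12)) * x ^ 2 + (Y ^ 2 / 12) * x
      + (Y ^ 5 / 60 - Y ^ 3 / 36) := by
    funext x; unfold shootR shootP; ring
  rw [hf]
  refine (hasDerivAt_quintic _ _ _ _ _ _ a).congr_deriv ?_
  ring

/-- `∂_a shootR1 a Y = -(a² - 1/6)(Y - a)` (the `(2,1)` Jacobian entry). -/
theorem hasDerivAt_shootR1_a (a Y : ℝ) :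
    HasDerivAt (fun a => shootR1 a Y) (-(a ^ 2 - 1/6) * (Y - a)) a := by
  have hf : (fun a => shootR1 a Y) = fun x : ℝ => 0 * x ^ 5 + (1/4) * x ^ 4 + (-(Y / 3)) * x ^ 3
      + (-1/12) * x ^ 2 + (Y / 6) * x + (Y ^ 4 / 12 - Y ^ 2 / 12) := by
    funext x; unfold shootR1; ring
  rw [hf]
  refine (hasDerivAt_quintic _ _ _ _ _ _ a).congr_deriv ?_
  ring

/-- The Jacobian of the shooting map `Ψ(a, c) = (shootR a c, shootR1 a c)` with respect to `(a, c)`: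
rows are the components, columns the partial derivatives `∂_a`, `∂_c`
(`hasDerivAt_shootR_a`, `hasDerivAt_shootR_Y`, `hasDerivAt_shootR1_a`, `hasDerivAt_shootR1_Y`). -/
noncomputable def landingJac (a c : ℝ) : Matrix (Fin 2) (Fin 2) ℝ :=
  !![-(a ^ 2 - 1/6) * (c - a) ^ 2 / 2, shootR1 a c; -(a ^ 2 - 1/6) * (c - a), shootR2 a c]

/-- At the landing the Jacobian is triangular: `[[-125/324, 0], [-25/54, 25/162]]`. -/
theorem landingJac_entries :
    landingJac (-2/3) 1 = !![-125/324, 0; -25/54, 25/162] := by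
  unfold landingJac shootR1 shootR2; norm_num

/-- NONDEGENERACY: `det DΨ(-2/3, 1) = -3125/52488 ≠ 0`, so the implicit function theorem continues the
landing pair `(a, c)` — hence the isolated low state — in any parameter on which the shooting map depends
`C¹`-smoothly (in particular in `η = x_e = √(δ/curv S)`, CLAIMS SB-C435). -/
theorem landingJac_det : (landingJac (-2/3) 1).det = -3125 / 52488 ∧ (landingJac (-2/3) 1).det ≠ 0 := by
  rw [landingJac_entries, Matrix.det_fin_two_of]
  constructor <;> norm_num

/-- Lift-off is strict: `R'''(a) = a² - 1/6 = 5/18 > 0` at `a = -2/3`, and the landing curvature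
`R''(c) = 25/162 > 0`; with `simR_pos` this gives positivity of the state on the open live interval,
which persists under `C¹`-small perturbations of the profile. -/
theorem liftoff_landing_signs : (0:ℝ) < (-2/3) ^ 2 - 1/6 ∧ (0:ℝ) < shootR2 (-2/3) 1 := by
  refine ⟨by norm_num, ?_⟩
  rw [shootR_landing.2.2]; norm_num

end Summit.AnomalousDissipation.AnomalousDissipation.Theorems
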